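import Mathlib
import HarnessLib
import Summits.Ventures.LatticeQCDFlow.Scoring.GeometricEnvelopeBlockSumMoments
import Summits.Ventures.LatticeQCDFlow.Scoring.ReversibleKernelTauIntFloor

/-!
# For a REVERSIBLE kernel the Green–Kubo variance of a bounded observable never degenerates:
# `σ²_f = 0 ⟺ f = πf` `π`-a.e. (geometric envelope); in general `∫ ((kop κ)^[2] h − h)² dπ ≤ σ²_f`

HONEST FRAMING: exact (Metropolis-corrected) sampling algorithms for lattice gauge theory;
figures of merit are autocorrelation/cost numbers at stated couplings and volumes; no
continuum-physics claim.

Venture `LatticeQCDFlow` (cell pub-lqcd), topic `Scoring`; FANOUT row 8 (`s0-cpn-nemc`, GEN-23).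
NEW WORK of the cell, not a published result; no definition is introduced; nothing is cited as a
fact.  Setting: a Markov kernel `κ` with the geometric sup-norm envelope
`|(kop κ)^[t] g − πg| ≤ 2 C_g A ρ^t` (`0 ≤ ρ < 1`) that is `π`-REVERSIBLE (Mathlib's
`Kernel.IsReversible κ π`, hence `π` invariant), `|f| ≤ C` measurable, `f̄ = f − πf`,
`σ²_f = ∫ f̄² dπ + 2 Σ' k, ∫ f̄ (kop κ)^[k+1] f̄ dπ`.  With `h` a bounded measurable Poisson solution
(`h − kop κ h = f̄`) the martingale form of the variance
(`Scoring/GeometricEnvelopeBlockSumMoments.poisson_condVar_integral_eq_greenKubo_of_envelope`) and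
invariance give `σ²_f = ∫ h² dπ − ∫ (kop κ h)² dπ`: the asymptotic variance is the `L²(π)`-norm the
transition operator LOSES on the Poisson solution.  For a reversible kernel
`∫ (kop κ h)² dπ = ∫ h · (kop κ)^[2] h dπ` (symmetry on observables,
`Scoring/ReversibleKernelTauIntFloor.integral_kop_mul_comm_of_isReversible`) and `kop κ` is an
`L²(π)`-contraction (`Scoring/DoeblinAutocorrelation.integral_sq_iterate_kop_le`), so
`∫ ((kop κ)^[2] h − h)² dπ = ∫ ((kop κ)^[2] h)² − 2 ∫ (kop κ h)² + ∫ h² ≤ ∫ h² − ∫ (kop κ h)² = σ²_f`: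
**the Poisson solution is `(kop κ)^[2]`-invariant up to `σ_f` in `L²(π)`**.  If `σ²_f = 0` then
`(kop κ)^[2] h = h` `π`-a.e., hence (since `kop κ` respects `π`-a.e. equality, by invariance)
`(kop κ)^[2t] h = h` `π`-a.e. for every `t`, and the envelope `(kop κ)^[2t] h → πh` forces `h = πh`
`π`-a.e., so `kop κ h = πh` `π`-a.e. and `f̄ = h − kop κ h = 0` `π`-a.e.  CONSEQUENCE: for every
reversible kernel of the envelope class (the exact flow / independence sampler, HMC with full momentum
refreshment, random-site heat-bath and Metropolis updates, palindromic sweeps — each `π`-reversible by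
construction) the positivity hypothesis `σ²_f > 0` of the row's studentised CLTs and exact-coverage
theorems holds for EVERY bounded observable that is not `π`-a.e. constant: the coboundary case of
`Scoring/GreenKuboDegenerate` (row 13's three-state example,
`Exactness/NCMCGeneralSpaceAsymptoticVarianceCounterexample`) is a non-reversible phenomenon.
Printed counterparts NAMED ONLY: positivity of the asymptotic variance for reversible chains via the
spectral measure, `σ²_f = ∫ (1+λ)/(1−λ) dE_f(λ)` (Kipnis–Varadhan 1986; Geyer 1992; Häggström–Rosenthal
2007) — nothing is cited as a fact; no spectral theory is used here.

## Content (`|f| ≤ C`, `|h| ≤ C_h` measurable; `π` a probability law)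

* `kop_congr_ae` — `π` invariant, `u = v` `π`-a.e. (bounded measurable) `⇒ kop κ u = kop κ v` `π`-a.e.;
  `iterate_kop_congr_ae` — the same for `(kop κ)^[t]`.
* `greenKubo_eq_zero_of_centred_ae_eq_zero`, `leadingBias_eq_zero_of_centred_ae_eq_zero` —
  `f̄ = 0` `π`-a.e. `⇒ σ²_f = 0` and `Γ_f = Σ' k, (k+1) γ_{k+1} = 0` (any kernel).
* **`greenKubo_eq_integral_sq_sub_of_envelope`** — `σ²_f = ∫ h² dπ − ∫ (kop κ h)² dπ` (envelope, `π`
  invariant, any bounded Poisson solution `h`).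
* **`integral_sq_iterate_two_sub_le_greenKubo_of_isReversible`** — reversible:
  `∫ ((kop κ)^[2] h − h)² dπ ≤ σ²_f`.
* **`centred_ae_eq_zero_of_greenKubo_eq_zero_of_isReversible`** — reversible + envelope:
  `σ²_f = 0 ⇒ f̄ = 0` `π`-a.e.; **`greenKubo_eq_zero_iff_centred_ae_eq_zero_of_isReversible`**;
  **`greenKubo_pos_of_not_centred_ae_eq_zero_of_isReversible`** — `¬(f̄ = 0 a.e.) ⇒ 0 < σ²_f`.

NOT CLAIMED: deterministic-scan sweeps (a product of reversible updates is not reversible in general —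
there the coboundary criterion of `Scoring/GreenKuboDegenerate` is the statement); a quantitative floor
`σ²_f ≥ c Var_π f` (row 13's one-step-minorisation floor is the quantitative statement available);
unbounded observables; any number of ours.
-/

noncomputable section

namespace Summit.Ventures.LatticeQCDFlow.Scoring

open MeasureTheory ProbabilityTheory Filter Finset Preorder Literature.Probability.MarkovChains
open scoped ENNReal Topology

variable {Ω : Type*} [MeasurableSpace Ω]

/-! ### `kop κ` respects `π`-a.e. equality (invariance) -/

section AE

variable (κ : Kernel Ω Ω) [IsMarkovKernel κ] {π : Measure Ω} [IsProbabilityMeasure π]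

/-- **`kop κ` respects `π`-a.e. equality** for `π` invariant: if `u = v` `π`-a.e. (both bounded
measurable) then `kop κ u = kop κ v` `π`-a.e. (`∫ |kop κ u − kop κ v| dπ ≤ ∫ kop κ |u − v| dπ = ∫ |u − v| dπ = 0`). -/
theorem kop_congr_ae (hπ : Kernel.Invariant κ π) {u v : Ω → ℝ} (hu : Measurable u) (hv : Measurable v)
    {Cu Cv : ℝ} (hCu : ∀ x, |u x| ≤ Cu) (hCv : ∀ x, |v x| ≤ Cv) (huv : u =ᵐ[π] v) :
    kop κ u =ᵐ[π] kop κ v := by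
  have hdm : Measurable fun y => |u y - v y| := (hu.sub hv).abs
  have hdb : ∀ y, |(fun y => |u y - v y|) y| ≤ Cu + Cv := fun y => by
    show |(|u y - v y|)| ≤ Cu + Cv
    rw [abs_abs]
    exact (abs_sub _ _).trans (add_le_add (hCu y) (hCv y))
  -- pointwise: `|K u x − K v x| ≤ K |u − v| x`
  have hpt : ∀ x, |kop κ u x - kop κ v x| ≤ kop κ (fun y => |u y - v y|) x := fun x => by
    have e : kop κ u x - kop κ v x = ∫ y, (u y - v y) ∂(κ x) := by
      unfold kop
      rw [integral_sub (integrable_of_bounded _ hu hCu) (integrable_of_bounded _ hv hCv)]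
    rw [e]
    exact abs_integral_le_integral_abs
  have h0 : ∫ y, |u y - v y| ∂π = 0 := by
    have e : ∫ y, |u y - v y| ∂π = ∫ _y, (0 : ℝ) ∂π :=
      integral_congr_ae (huv.mono fun y hy => by
        show |u y - v y| = 0
        rw [hy, sub_self, abs_zero])
    rw [e, integral_zero]
  have hKm : Measurable fun x => |kop κ u x - kop κ v x| :=
    ((measurable_kop κ hu).sub (measurable_kop κ hv)).abs
  have hKi : Integrable (fun x => |kop κ u x - kop κ v x|) π :=
    integrable_of_bounded π hKm (C := Cu + Cv) fun x => by
      rw [abs_abs]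
      exact (hpt x).trans ((le_abs_self _).trans (abs_kop_le κ hdb x))
  have hK0 : ∫ x, |kop κ u x - kop κ v x| ∂π = 0 := by
    refine le_antisymm ?_ (integral_nonneg fun x => abs_nonneg _)
    calc ∫ x, |kop κ u x - kop κ v x| ∂π ≤ ∫ x, kop κ (fun y => |u y - v y|) x ∂π :=
          integral_mono hKi (integrable_of_bounded π (measurable_kop κ hdm) (abs_kop_le κ hdb)) hpt
      _ = ∫ y, |u y - v y| ∂π := integral_kop κ hπ hdm hdb
      _ = 0 := h0
  have hae := (integral_eq_zero_iff_of_nonneg (fun x => abs_nonneg _) hKi).1 hK0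
  exact hae.mono fun x hx => sub_eq_zero.1 (abs_eq_zero.1 hx)

/-- `(kop κ)^[t]` respects `π`-a.e. equality (`π` invariant, bounded measurable observables). -/
theorem iterate_kop_congr_ae (hπ : Kernel.Invariant κ π) {u v : Ω → ℝ} (hu : Measurable u)
    (hv : Measurable v) {Cu Cv : ℝ} (hCu : ∀ x, |u x| ≤ Cu) (hCv : ∀ x, |v x| ≤ Cv)
    (huv : u =ᵐ[π] v) : ∀ t : ℕ, (kop κ)^[t] u =ᵐ[π] (kop κ)^[t] v := by
  intro t
  induction t with
  | zero => exact huv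
  | succ t ih =>
    obtain ⟨hum, hub⟩ := iterate_kop_bounded_measurable κ hu hCu t
    obtain ⟨hvm, hvb⟩ := iterate_kop_bounded_measurable κ hv hCv t
    rw [Function.iterate_succ_apply', Function.iterate_succ_apply']
    exact kop_congr_ae κ hπ hum hvm hub hvb ih

end AE

/-! ### `f̄ = 0` a.e. kills the variance and the leading-bias constant (any kernel) -/

section Trivial

variable {κ : Kernel Ω Ω} {π : Measure Ω}

/-- `f̄ =ᵐ[π] 0 ⇒` every lag term `∫ f̄ · (kop κ)^[k+1] f̄ dπ` vanishes, hence `σ²_f = 0`. -/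
theorem greenKubo_eq_zero_of_centred_ae_eq_zero {f : Ω → ℝ}
    (h0 : (fun y => f y - ∫ z, f z ∂π) =ᵐ[π] 0) :
    (∫ y, (f y - ∫ z, f z ∂π) ^ 2 ∂π)
        + 2 * ∑' k, ∫ y, (f y - ∫ z, f z ∂π) * (kop κ)^[k + 1] (fun y => f y - ∫ z, f z ∂π) y ∂π
      = 0 := by
  have h1 : ∫ y, (f y - ∫ z, f z ∂π) ^ 2 ∂π = 0 := by
    have e : ∫ y, (f y - ∫ z, f z ∂π) ^ 2 ∂π = ∫ _y, (0 : ℝ) ∂π :=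
      integral_congr_ae (h0.mono fun y hy => by
        have hy' : f y - ∫ z, f z ∂π = 0 := hy
        simp [hy'])
    rw [e, integral_zero]
  have h2 : ∀ k, ∫ y, (f y - ∫ z, f z ∂π) * (kop κ)^[k + 1] (fun y => f y - ∫ z, f z ∂π) y ∂π = 0 := by
    intro k
    have e : ∫ y, (f y - ∫ z, f z ∂π) * (kop κ)^[k + 1] (fun y => f y - ∫ z, f z ∂π) y ∂π
        = ∫ _y, (0 : ℝ) ∂π :=
      integral_congr_ae (h0.mono fun y hy => by
        have hy' : f y - ∫ z, f z ∂π = 0 := hy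
        show (f y - ∫ z, f z ∂π) * _ = 0
        rw [hy', zero_mul])
    rw [e, integral_zero]
  simp only [h1, h2, tsum_zero, mul_zero, add_zero]

/-- `f̄ =ᵐ[π] 0 ⇒ Γ_f = Σ' k, (k+1) ∫ f̄ · (kop κ)^[k+1] f̄ dπ = 0`. -/
theorem leadingBias_eq_zero_of_centred_ae_eq_zero {f : Ω → ℝ}
    (h0 : (fun y => f y - ∫ z, f z ∂π) =ᵐ[π] 0) :
    ∑' k : ℕ, ((k : ℝ) + 1)
        * ∫ y, (f y - ∫ z, f z ∂π) * (kop κ)^[k + 1] (fun y => f y - ∫ z, f z ∂π) y ∂π = 0 := by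
  have h2 : ∀ k, ∫ y, (f y - ∫ z, f z ∂π) * (kop κ)^[k + 1] (fun y => f y - ∫ z, f z ∂π) y ∂π = 0 := by
    intro k
    have e : ∫ y, (f y - ∫ z, f z ∂π) * (kop κ)^[k + 1] (fun y => f y - ∫ z, f z ∂π) y ∂π
        = ∫ _y, (0 : ℝ) ∂π :=
      integral_congr_ae (h0.mono fun y hy => by
        have hy' : f y - ∫ z, f z ∂π = 0 := hy
        show (f y - ∫ z, f z ∂π) * _ = 0
        rw [hy', zero_mul])
    rw [e, integral_zero]
  simp only [h2, mul_zero, tsum_zero]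

end Trivial

/-! ### The variance as the `L²(π)`-norm lost by `kop κ` on the Poisson solution -/

section Envelope

variable {κ : Kernel Ω Ω} [IsMarkovKernel κ] {π : Measure Ω} [IsProbabilityMeasure π] {A ρ : ℝ}

/-- **`σ²_f = ∫ h² dπ − ∫ (kop κ h)² dπ`** for every bounded measurable Poisson solution `h`
(`h − kop κ h = f − πf`), under the envelope with `π` invariant (`0 ≤ ρ < 1`). -/
theorem greenKubo_eq_integral_sq_sub_of_envelope (hπ : Kernel.Invariant κ π)
    (henv : ∀ (g : Ω → ℝ), Measurable g → ∀ (Cg : ℝ), (∀ x, |g x| ≤ Cg) →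
      ∀ (t : ℕ) (x : Ω), |(kop κ)^[t] g x - ∫ y, g y ∂π| ≤ 2 * Cg * (A * ρ ^ t))
    (hρ0 : 0 ≤ ρ) (hρ1 : ρ < 1)
    {f : Ω → ℝ} (hf : Measurable f) {C : ℝ} (hC : ∀ x, |f x| ≤ C)
    {h : Ω → ℝ} (hh : Measurable h) {Ch : ℝ} (hCh : ∀ x, |h x| ≤ Ch)
    (hpois : ∀ y, h y - kop κ h y = f y - ∫ z, f z ∂π) :
    (∫ y, (f y - ∫ z, f z ∂π) ^ 2 ∂π)
        + 2 * ∑' k, ∫ y, (f y - ∫ z, f z ∂π) * (kop κ)^[k + 1] (fun y => f y - ∫ z, f z ∂π) y ∂π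
      = ∫ y, h y ^ 2 ∂π - ∫ y, (kop κ h y) ^ 2 ∂π := by
  rw [← poisson_condVar_integral_eq_greenKubo_of_envelope hπ henv hρ0 hρ1 hf hC hh hCh hpois]
  have hh2 : Measurable fun y => h y ^ 2 := hh.pow_const 2
  have hCh2 : ∀ y, |h y ^ 2| ≤ Ch ^ 2 := fun y => by
    rw [abs_pow]; exact pow_le_pow_left₀ (abs_nonneg _) (hCh y) 2
  have hi1 : Integrable (fun y => kop κ (fun z => h z ^ 2) y) π :=
    integrable_of_bounded π (measurable_kop κ hh2) (abs_kop_le κ hCh2)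
  have hi2 : Integrable (fun y => (kop κ h y) ^ 2) π :=
    integrable_of_bounded π ((measurable_kop κ hh).pow_const 2) (C := Ch ^ 2) fun y => by
      rw [abs_pow]; exact pow_le_pow_left₀ (abs_nonneg _) (abs_kop_le κ hCh y) 2
  rw [integral_sub hi1 hi2, integral_kop κ hπ hh2 hCh2]

/-- **REVERSIBLE: the Poisson solution is `(kop κ)^[2]`-invariant up to `σ_f` in `L²(π)`**:
`∫ ((kop κ)^[2] h − h)² dπ ≤ σ²_f` (envelope, `κ` `π`-reversible, `h − kop κ h = f − πf` bounded
measurable). -/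
theorem integral_sq_iterate_two_sub_le_greenKubo_of_isReversible (hrev : Kernel.IsReversible κ π)
    (henv : ∀ (g : Ω → ℝ), Measurable g → ∀ (Cg : ℝ), (∀ x, |g x| ≤ Cg) →
      ∀ (t : ℕ) (x : Ω), |(kop κ)^[t] g x - ∫ y, g y ∂π| ≤ 2 * Cg * (A * ρ ^ t))
    (hρ0 : 0 ≤ ρ) (hρ1 : ρ < 1)
    {f : Ω → ℝ} (hf : Measurable f) {C : ℝ} (hC : ∀ x, |f x| ≤ C)
    {h : Ω → ℝ} (hh : Measurable h) {Ch : ℝ} (hCh : ∀ x, |h x| ≤ Ch)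
    (hpois : ∀ y, h y - kop κ h y = f y - ∫ z, f z ∂π) :
    ∫ y, ((kop κ)^[2] h y - h y) ^ 2 ∂π
      ≤ (∫ y, (f y - ∫ z, f z ∂π) ^ 2 ∂π)
        + 2 * ∑' k, ∫ y, (f y - ∫ z, f z ∂π) * (kop κ)^[k + 1] (fun y => f y - ∫ z, f z ∂π) y ∂π := by
  have hπ : Kernel.Invariant κ π := hrev.invariant
  have e2 : (kop κ)^[2] h = kop κ (kop κ h) := rfl
  rw [greenKubo_eq_integral_sq_sub_of_envelope hπ henv hρ0 hρ1 hf hC hh hCh hpois, e2]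
  have hCh0 : 0 ≤ Ch := (abs_nonneg _).trans (hCh (Classical.choice (nonempty_of_isProbabilityMeasure π)))
  have hKm : Measurable (kop κ h) := measurable_kop κ hh
  have hKb : ∀ y, |kop κ h y| ≤ Ch := abs_kop_le κ hCh
  have hK2m : Measurable (kop κ (kop κ h)) := measurable_kop κ hKm
  have hK2b : ∀ y, |kop κ (kop κ h) y| ≤ Ch := abs_kop_le κ hKb
  -- symmetry: `∫ (Kh)² = ∫ h · K(Kh)`
  have hsymm : ∫ y, (kop κ h y) ^ 2 ∂π = ∫ y, h y * kop κ (kop κ h) y ∂π := by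
    have e := integral_kop_mul_comm_of_isReversible κ hrev hh hKm hCh hKb
    have e1 : ∫ y, (kop κ h y) ^ 2 ∂π = ∫ y, kop κ h y * kop κ h y ∂π :=
      integral_congr_ae (ae_of_all _ fun y => by ring)
    rw [e1, e]
  -- contraction: `∫ (K²h)² ≤ ∫ (Kh)²`
  have hcontr : ∫ y, (kop κ (kop κ h) y) ^ 2 ∂π ≤ ∫ y, (kop κ h y) ^ 2 ∂π := by
    have := integral_sq_iterate_kop_le κ hπ hKm hKb 1
    simpa only [Function.iterate_one] using this
  -- expand the square
  have hi1 : Integrable (fun y => (kop κ (kop κ h) y) ^ 2) π :=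
    integrable_of_bounded π (hK2m.pow_const 2) (C := Ch ^ 2) fun y => by
      rw [abs_pow]; exact pow_le_pow_left₀ (abs_nonneg _) (hK2b y) 2
  have hi2 : Integrable (fun y => h y * kop κ (kop κ h) y) π :=
    integrable_of_bounded π (hh.mul hK2m) (C := Ch * Ch) fun y => by
      rw [abs_mul]; exact mul_le_mul (hCh y) (hK2b y) (abs_nonneg _) hCh0
  have hi3 : Integrable (fun y => h y ^ 2) π :=
    integrable_of_bounded π (hh.pow_const 2) (C := Ch ^ 2) fun y => by
      rw [abs_pow]; exact pow_le_pow_left₀ (abs_nonneg _) (hCh y) 2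
  have hexp : (fun y => (kop κ (kop κ h) y - h y) ^ 2)
      = fun y => ((kop κ (kop κ h) y) ^ 2 - 2 * (h y * kop κ (kop κ h) y)) + h y ^ 2 := by
    funext y; ring
  have hi12 : Integrable (fun y => (kop κ (kop κ h) y) ^ 2 - 2 * (h y * kop κ (kop κ h) y)) π :=
    hi1.sub (hi2.const_mul 2)
  have hi2' : Integrable (fun y => 2 * (h y * kop κ (kop κ h) y)) π := hi2.const_mul 2
  rw [hexp, integral_add hi12 hi3, integral_sub hi1 hi2', integral_const_mul, ← hsymm]
  linarith

/-- **REVERSIBLE + ENVELOPE: `σ²_f = 0 ⇒ f = πf` `π`-a.e.** — a reversible kernel of the envelope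
class has NO degenerate bounded observable other than the `π`-a.e. constants. -/
theorem centred_ae_eq_zero_of_greenKubo_eq_zero_of_isReversible (hrev : Kernel.IsReversible κ π)
    (henv : ∀ (g : Ω → ℝ), Measurable g → ∀ (Cg : ℝ), (∀ x, |g x| ≤ Cg) →
      ∀ (t : ℕ) (x : Ω), |(kop κ)^[t] g x - ∫ y, g y ∂π| ≤ 2 * Cg * (A * ρ ^ t))
    (hρ0 : 0 ≤ ρ) (hρ1 : ρ < 1)
    {f : Ω → ℝ} (hf : Measurable f) {C : ℝ} (hC : ∀ x, |f x| ≤ C)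
    (hσ : (∫ y, (f y - ∫ z, f z ∂π) ^ 2 ∂π)
        + 2 * ∑' k, ∫ y, (f y - ∫ z, f z ∂π) * (kop κ)^[k + 1] (fun y => f y - ∫ z, f z ∂π) y ∂π
        = 0) :
    (fun y => f y - ∫ z, f z ∂π) =ᵐ[π] 0 := by
  have hπ : Kernel.Invariant κ π := hrev.invariant
  obtain ⟨h, hh, hCh, hpois⟩ := poisson_exists_of_geometricEnvelope henv hρ0 hρ1 hf hC
  set Ch : ℝ := 4 * C * A / (1 - ρ) with hChdef
  have hKm : Measurable (kop κ h) := measurable_kop κ hh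
  have hKb : ∀ y, |kop κ h y| ≤ Ch := abs_kop_le κ hCh
  have hK2m : Measurable ((kop κ)^[2] h) := measurable_kop κ hKm
  have hK2b : ∀ y, |(kop κ)^[2] h y| ≤ Ch := abs_kop_le κ hKb
  -- Step 1: `K²h = h` a.e.
  have hsq0 : ∫ y, ((kop κ)^[2] h y - h y) ^ 2 ∂π = 0 := by
    refine le_antisymm ?_ (integral_nonneg fun y => sq_nonneg _)
    have := integral_sq_iterate_two_sub_le_greenKubo_of_isReversible hrev henv hρ0 hρ1 hf hC hh hCh
      hpois
    rwa [hσ] at this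
  have hdb : ∀ y, |(kop κ)^[2] h y - h y| ≤ Ch + Ch := fun y =>
    (abs_sub _ _).trans (add_le_add (hK2b y) (hCh y))
  have hid : Integrable (fun y => ((kop κ)^[2] h y - h y) ^ 2) π :=
    integrable_of_bounded π ((hK2m.sub hh).pow_const 2) (C := (Ch + Ch) ^ 2) fun y => by
      rw [abs_pow]; exact pow_le_pow_left₀ (abs_nonneg _) (hdb y) 2
  have hae2 : (kop κ)^[2] h =ᵐ[π] h :=
    ((integral_eq_zero_iff_of_nonneg (fun y => sq_nonneg _) hid).1 hsq0).mono fun y hy =>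
      sub_eq_zero.1 (pow_eq_zero_iff two_ne_zero |>.1 hy)
  -- Step 2: `K^{2t} h = h` a.e. for every `t`
  have haeT : ∀ t : ℕ, (kop κ)^[2 * t] h =ᵐ[π] h := by
    intro t
    induction t with
    | zero => exact ae_eq_refl _
    | succ t ih =>
      have e : (kop κ)^[2 * (t + 1)] h = (kop κ)^[2 * t] ((kop κ)^[2] h) := by
        rw [← Function.iterate_add_apply, show 2 * (t + 1) = 2 * t + 2 by ring]
      rw [e]
      exact (iterate_kop_congr_ae κ hπ hK2m hh hK2b hCh hae2 (2 * t)).trans ih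
  -- Step 3: along a.e. path, `h x = K^{2t} h x → πh`, so `h = πh` a.e.
  set m := ∫ y, h y ∂π with hm
  have hall : ∀ᵐ x ∂π, ∀ t : ℕ, (kop κ)^[2 * t] h x = h x := by
    rw [ae_all_iff]
    intro t
    exact haeT t
  have hconst : (fun y => h y - m) =ᵐ[π] 0 := by
    filter_upwards [hall] with x hx
    show h x - m = 0
    have hlim : Tendsto (fun t : ℕ => (kop κ)^[2 * t] h x) atTop (𝓝 m) := by
      have hgeo : Tendsto (fun t : ℕ => 2 * Ch * (A * ρ ^ (2 * t))) atTop (𝓝 0) := by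
        have h2 : Tendsto (fun t : ℕ => (ρ ^ 2) ^ t) atTop (𝓝 0) :=
          tendsto_pow_atTop_nhds_zero_of_lt_one (sq_nonneg ρ)
            (by nlinarith [hρ0, hρ1] : ρ ^ 2 < 1)
        have := (h2.const_mul (2 * Ch * A))
        simp only [mul_zero] at this
        refine this.congr fun t => ?_
        rw [pow_mul]; ring
      have hbound : ∀ t : ℕ, |(kop κ)^[2 * t] h x - m| ≤ 2 * Ch * (A * ρ ^ (2 * t)) := fun t =>
        henv h hh Ch hCh (2 * t) x
      have h0 : Tendsto (fun t : ℕ => (kop κ)^[2 * t] h x - m) atTop (𝓝 0) :=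
        squeeze_zero_norm (fun t => by simpa only [Real.norm_eq_abs] using hbound t) hgeo
      have h1 := h0.add_const m
      simp only [sub_add_cancel, zero_add] at h1
      exact h1
    have hcst : Tendsto (fun t : ℕ => (kop κ)^[2 * t] h x) atTop (𝓝 (h x)) :=
      tendsto_const_nhds.congr fun t => (hx t).symm
    have := tendsto_nhds_unique hcst hlim
    linarith
  -- Step 4: `Kh = m` a.e. too, so `f̄ = h − Kh = 0` a.e.
  have hKconst : kop κ h =ᵐ[π] kop κ (fun _ => m) :=
    kop_congr_ae κ hπ hh measurable_const hCh (Cv := |m|) (fun _ => le_rfl)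
      (hconst.mono fun y hy => by
        have hy' : h y - m = 0 := hy
        show h y = m
        linarith)
  have hKm_eq : kop κ (fun _ : Ω => m) = fun _ => m := kop_const (κ := κ) m
  filter_upwards [hconst, hKconst] with y h1 h2
  have h1' : h y - m = 0 := h1
  rw [hKm_eq] at h2
  show f y - ∫ z, f z ∂π = (0 : Ω → ℝ) y
  rw [← hpois y, Pi.zero_apply, h2]
  linarith

/-- **REVERSIBLE + ENVELOPE: `σ²_f = 0 ⟺ f = πf` `π`-a.e.** -/
theorem greenKubo_eq_zero_iff_centred_ae_eq_zero_of_isReversible (hrev : Kernel.IsReversible κ π)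
    (henv : ∀ (g : Ω → ℝ), Measurable g → ∀ (Cg : ℝ), (∀ x, |g x| ≤ Cg) →
      ∀ (t : ℕ) (x : Ω), |(kop κ)^[t] g x - ∫ y, g y ∂π| ≤ 2 * Cg * (A * ρ ^ t))
    (hρ0 : 0 ≤ ρ) (hρ1 : ρ < 1)
    {f : Ω → ℝ} (hf : Measurable f) {C : ℝ} (hC : ∀ x, |f x| ≤ C) :
    (∫ y, (f y - ∫ z, f z ∂π) ^ 2 ∂π)
        + 2 * ∑' k, ∫ y, (f y - ∫ z, f z ∂π) * (kop κ)^[k + 1] (fun y => f y - ∫ z, f z ∂π) y ∂π = 0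
      ↔ (fun y => f y - ∫ z, f z ∂π) =ᵐ[π] 0 :=
  ⟨centred_ae_eq_zero_of_greenKubo_eq_zero_of_isReversible hrev henv hρ0 hρ1 hf hC,
    greenKubo_eq_zero_of_centred_ae_eq_zero⟩

/-- **REVERSIBLE + ENVELOPE: every bounded observable that is not `π`-a.e. constant has `σ²_f > 0`**
— the positivity hypothesis of the row's studentised CLTs, discharged for reversible kernels. -/
theorem greenKubo_pos_of_not_centred_ae_eq_zero_of_isReversible (hrev : Kernel.IsReversible κ π)
    (henv : ∀ (g : Ω → ℝ), Measurable g → ∀ (Cg : ℝ), (∀ x, |g x| ≤ Cg) →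
      ∀ (t : ℕ) (x : Ω), |(kop κ)^[t] g x - ∫ y, g y ∂π| ≤ 2 * Cg * (A * ρ ^ t))
    (hρ0 : 0 ≤ ρ) (hρ1 : ρ < 1)
    {f : Ω → ℝ} (hf : Measurable f) {C : ℝ} (hC : ∀ x, |f x| ≤ C)
    (hne : ¬ ((fun y => f y - ∫ z, f z ∂π) =ᵐ[π] 0)) :
    0 < (∫ y, (f y - ∫ z, f z ∂π) ^ 2 ∂π)
        + 2 * ∑' k, ∫ y, (f y - ∫ z, f z ∂π) * (kop κ)^[k + 1] (fun y => f y - ∫ z, f z ∂π) y ∂π := by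
  rcases (greenKubo_nonneg_of_envelope hrev.invariant henv hρ0 hρ1 hf hC).eq_or_lt with h0 | hpos
  · exact absurd (centred_ae_eq_zero_of_greenKubo_eq_zero_of_isReversible hrev henv hρ0 hρ1 hf hC
      h0.symm) hne
  · exact hpos

end Envelope

end Summit.Ventures.LatticeQCDFlow.Scoring

end
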